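import Summits.ValiantsHypothesis.ValiantsHypothesis.Theorems.KPlusLogSqLawTropicalSymmetricThreeKRail
import Summits.ValiantsHypothesis.ValiantsHypothesis.Theorems.KPlusLogSqLawSymmetricDesignGraft

/-!
# Route «KPlusLogSqLaw» — the RAIL RAY and QUADRANT: the `(3,10)` rail design grafted and bordered,
# `ζ₊sym(3,K) ≥ 3K + 21`, `ζ₊sym(4,K) ≥ 4K + 20`, `ζ₊sym(5,K) ≥ 5K + 19` for every `K ≥ 10`

HONEST FRAMING.  Helper file (seat typer (g11), cell `pub-symmetroid`, 2026-08-27; desk R1621 / R1624; `--supports` the `WeakLifting`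
item stmt-ValiantsHypothesis-19561 as a helper, no closure claim).  Numeral instances only, no definitions.  LOWER census floors: the
symmetric `(3,10)` rail design of theory-2 (g19) (`KPlusLogSqLaw.symmDesign_three_ten_rail_attained`: `52` uniquely dominant terms,
`51` alternations, hence `ζ₊sym(3,10) ≥ 51`, `KPlusLogSqLaw.not_posRootLawAt_three_ten_50`) fed to the SYMMETRIC DESIGNS GRAFT
(`TropicalCensus.not_posRootLawAt_add_of_symmDesign_row`: patchworking + the graft law, `+3` zeros per further letter at `m = 3`) and to
its BILINEAR form (`TropicalCensus.not_posRootLawAt_bilinear_of_symmDesign_row`: `+9` zeros per further row/column at `10` letters, then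
`+(3 + i)` per further letter):
* RAY — **`¬ PosRootLawAt 3 (10 + j) (50 + 3j)` for every `j`**, i.e. `ζ₊sym(3,K) ≥ 3K + 21` for every `K ≥ 10`
  (`not_posRootLawAt_three_rail_ray`), numeral rows `(3,11) ≥ 54`, `(3,12) ≥ 57`, `(3,13) ≥ 60`, `(3,14) ≥ 63`;
* QUADRANT — **`¬ PosRootLawAt (3 + i) (10 + j) (50 + 9i + j(3 + i))` for all `i, j`** (`not_posRootLawAt_rail_quadrant`), in closed
  form `ζ₊sym(4,K) ≥ 4K + 20` (`not_posRootLawAt_four_rail_ray`) and `ζ₊sym(5,K) ≥ 5K + 19` (`not_posRootLawAt_five_rail_ray`) for every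
  `K ≥ 10`, numeral rows `(4,10) ≥ 60`, `(4,11) ≥ 64`, `(5,10) ≥ 69`, `(5,11) ≥ 74`;
* BORDERED ONCE at `K = 8, 9` — the `(3,8)` / `(3,9)` rail designs (`39` / `45` alternations) give `ζ₊sym(4,8) ≥ 46` and `ζ₊sym(4,9) ≥ 53`
  (`rail_border_4_8`, `rail_border_4_9`; tree before: `44`, `48`).
Against the tree (rays of grafted census certificates, seat val-sym-mdr-p1 (g3)): `Census.Graft.RayM3K7F35.ray` gives `3K + 14`
(`(3,11) ≥ 47`), `Census.Graft.RayM4K4C28.ray` gives `4K + 12`, `Census.Graft.RayM5K4C37.ray` gives `5K + 17`, and the all-format floor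
`Census.Graft.not_posRootLawAt_graft` gives `m² + (K − 2)m`; so from `K = 10` on these rows are new kernel floors by `+7` (`m = 3`),
`+8` (`m = 4`), `+2` (`m = 5`); at `m ≥ 6` the quadrant (`6K + 18`, …) is BELOW the all-format floor (`6K + 24`, …) and is not stated;
the rays of the `(3,8)` / `(3,9)` rail designs are dominated and not stated.  The cell's located RAIL LAW `6K − 9 = P(3,K)` (theory-2
g19; designs rendered through `K = 10` only) predicts more at every `K ≥ 11`; a rendered `(3,K)` rail design retires the `m = 3` instance
at that `K` (and improves the quadrant), not the bridge.  Nothing here bears on DoorA26 / DoorA34 (`PosRootLawAt 2 6 19` /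
`PosRootLawAt 3 4 18`, OPEN, typed, never asserted), on `TropicalB` / `WeakLifting`, on `MatrixDescartes` (stmt-ValiantsHypothesis-18050)
or on `VP ≠ VNP`; a lower census bound refutes no law of record.  [folklore]
-/

-- `Summit.ValiantsHypothesis.ValiantsHypothesis.…` repeats a component by the D-0017 layout
-- (single-conjunct summit), which the `dupNamespace` linter flags; the name is mandated.
set_option linter.dupNamespace false
set_option autoImplicit false

namespace Summit.ValiantsHypothesis.ValiantsHypothesis.Theorems.KPlusLogSqLaw

open Summit.ValiantsHypothesis.ValiantsHypothesis.Theorems.MatrixDescartes.Negative (PosRootLawAt)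
open Summit.ValiantsHypothesis.ValiantsHypothesis.Theorems.LacunarySymmetroidMatrixDescartes.TropicalCensus

/-! ### The ray (`m = 3`) -/

/-- **The rail ray from `(3,10)`**: for every `j`, `¬ PosRootLawAt 3 (10 + j) (50 + j·3)` — some real symmetric `(10 + j)`-term
`3 × 3` lacunary pencil has at least `51 + 3j` distinct positive determinant zeros (the patchworked `(3,10)` rail design grafted `j` times).
[folklore] -/
theorem not_posRootLawAt_three_ten_rail_ray (j : ℕ) : ¬ PosRootLawAt 3 (10 + j) (50 + j * 3) := by
  have h := not_posRootLawAt_add_of_symmDesign_row (by norm_num) symmDesign_three_ten_rail_attained j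
  have e : 51 + j * 3 - 1 = 50 + j * 3 := by omega
  rw [e] at h
  exact h

/-- **`ζ₊sym(3,K) ≥ 3K + 21` for every `K ≥ 10`** — `¬ PosRootLawAt 3 K (3K + 20)` (the rail ray in closed form; tree ray of record
before this file: `3K + 14`, `Census.Graft.RayM3K7F35.ray`). [folklore] -/
theorem not_posRootLawAt_three_rail_ray (K : ℕ) (hK : 10 ≤ K) : ¬ PosRootLawAt 3 K (3 * K + 20) := by
  obtain ⟨j, rfl⟩ := Nat.exists_eq_add_of_le hK
  have h := not_posRootLawAt_three_ten_rail_ray j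
  have e : 50 + j * 3 = 3 * (10 + j) + 20 := by omega
  rw [e] at h
  exact h

/-! ### The quadrant (`m = 3 + i`) -/

/-- **The rail quadrant from `(3,10)`**: for all `i, j`, `¬ PosRootLawAt (3 + i) (10 + j) (50 + i·9 + j·(3 + i))` — the patchworked
`(3,10)` rail design bordered `i` times (`+9` zeros each) and grafted `j` times (`+(3 + i)` zeros each): `ζ₊sym(3 + i, 10 + j) ≥
51 + 9i + j(3 + i)`. [folklore] -/
theorem not_posRootLawAt_rail_quadrant (i j : ℕ) : ¬ PosRootLawAt (3 + i) (10 + j) (50 + i * 9 + j * (3 + i)) := by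
  have h := not_posRootLawAt_bilinear_of_symmDesign_row (by norm_num) symmDesign_three_ten_rail_attained i j
  have e : 51 + i * 9 + j * (3 + i) - 1 = 50 + i * 9 + j * (3 + i) := by omega
  rw [e] at h
  exact h

/-- **`ζ₊sym(4,K) ≥ 4K + 20` for every `K ≥ 10`** — `¬ PosRootLawAt 4 K (4K + 19)` (tree ray of record before this file: `4K + 12`,
`Census.Graft.RayM4K4C28.ray`). [folklore] -/
theorem not_posRootLawAt_four_rail_ray (K : ℕ) (hK : 10 ≤ K) : ¬ PosRootLawAt 4 K (4 * K + 19) := by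
  obtain ⟨j, rfl⟩ := Nat.exists_eq_add_of_le hK
  have h := not_posRootLawAt_rail_quadrant 1 j
  have e : 50 + 1 * 9 + j * (3 + 1) = 4 * (10 + j) + 19 := by omega
  rw [e] at h
  exact h

/-- **`ζ₊sym(5,K) ≥ 5K + 19` for every `K ≥ 10`** — `¬ PosRootLawAt 5 K (5K + 18)` (tree ray of record before this file: `5K + 17`,
`Census.Graft.RayM5K4C37.ray`). [folklore] -/
theorem not_posRootLawAt_five_rail_ray (K : ℕ) (hK : 10 ≤ K) : ¬ PosRootLawAt 5 K (5 * K + 18) := by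
  obtain ⟨j, rfl⟩ := Nat.exists_eq_add_of_le hK
  have h := not_posRootLawAt_rail_quadrant 2 j
  have e : 50 + 2 * 9 + j * (3 + 2) = 5 * (10 + j) + 18 := by omega
  rw [e] at h
  exact h

/-! ### Numeral rows (census format `(m,K) ≥ B + 1` reads `¬ PosRootLawAt m K B`) -/

/-- `ζ₊sym(3,11) ≥ 54` (tree before: `≥ 47`, `Census.Graft.RayM3K7F35.row_3_11`). [folklore] -/
theorem rail_ray_3_11 : ¬ PosRootLawAt 3 11 53 := by
  have h := not_posRootLawAt_three_ten_rail_ray 1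
  norm_num at h
  exact h

/-- `ζ₊sym(3,12) ≥ 57`. [folklore] -/
theorem rail_ray_3_12 : ¬ PosRootLawAt 3 12 56 := by
  have h := not_posRootLawAt_three_ten_rail_ray 2
  norm_num at h
  exact h

/-- `ζ₊sym(3,13) ≥ 60`. [folklore] -/
theorem rail_ray_3_13 : ¬ PosRootLawAt 3 13 59 := by
  have h := not_posRootLawAt_three_ten_rail_ray 3
  norm_num at h
  exact h

/-- `ζ₊sym(3,14) ≥ 63`. [folklore] -/
theorem rail_ray_3_14 : ¬ PosRootLawAt 3 14 62 := by
  have h := not_posRootLawAt_three_ten_rail_ray 4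
  norm_num at h
  exact h

/-- `ζ₊sym(4,10) ≥ 60` (tree before: `≥ 52` by `Census.Graft.RayM4K4C28.ray 6`). [folklore] -/
theorem rail_quadrant_4_10 : ¬ PosRootLawAt 4 10 59 := by
  have h := not_posRootLawAt_rail_quadrant 1 0
  norm_num at h
  exact h

/-- `ζ₊sym(4,11) ≥ 64`. [folklore] -/
theorem rail_quadrant_4_11 : ¬ PosRootLawAt 4 11 63 := by
  have h := not_posRootLawAt_rail_quadrant 1 1
  norm_num at h
  exact h

/-- `ζ₊sym(5,10) ≥ 69` (tree before: `≥ 67` by `Census.Graft.RayM5K4C37.ray 6`). [folklore] -/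
theorem rail_quadrant_5_10 : ¬ PosRootLawAt 5 10 68 := by
  have h := not_posRootLawAt_rail_quadrant 2 0
  norm_num at h
  exact h

/-- `ζ₊sym(5,11) ≥ 74`. [folklore] -/
theorem rail_quadrant_5_11 : ¬ PosRootLawAt 5 11 73 := by
  have h := not_posRootLawAt_rail_quadrant 2 1
  norm_num at h
  exact h


/-! ### The `(3,8)` and `(3,9)` rail designs bordered once (`m = 4` at `K = 8, 9`) -/

/-- `ζ₊sym(4,8) ≥ 46`: the `(3,8)` rail design (`39` alternations) bordered once (`+7`) — `¬ PosRootLawAt 4 8 45` (tree before: `≥ 44`,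
`Census.Graft.RayM4K4C28.row_4_8`). [folklore] -/
theorem rail_border_4_8 : ¬ PosRootLawAt 4 8 45 := by
  have h := not_posRootLawAt_bilinear_of_symmDesign_row (by norm_num) symmDesign_three_eight_rail_attained 1 0
  norm_num at h
  exact h

/-- `ζ₊sym(4,9) ≥ 53`: the `(3,9)` rail design (`45` alternations) bordered once (`+8`) — `¬ PosRootLawAt 4 9 52` (tree before: `≥ 48`,
`Census.Graft.RayM4K4C28.ray 5`). [folklore] -/
theorem rail_border_4_9 : ¬ PosRootLawAt 4 9 52 := by
  have h := not_posRootLawAt_bilinear_of_symmDesign_row (by norm_num) symmDesign_three_nine_rail_attained 1 0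
  norm_num at h
  exact h

end Summit.ValiantsHypothesis.ValiantsHypothesis.Theorems.KPlusLogSqLaw
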